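import Summits.HubbardSuperconductivity.HubbardSuperconductivity.Statement
import Summits.HubbardSuperconductivity.HubbardSuperconductivity.Theorems.NodalDiracTwistBridgeNodalToDWaveNDSpeaksFrequently
import Summits.HubbardSuperconductivity.HubbardSuperconductivity.Theorems.NodalDiracTwistBridgeNodalToDWaveUniqueGroundState
import Summits.HubbardSuperconductivity.HubbardSuperconductivity.Theorems.NodalDiracTwistBridgeNodalToDWaveSubsequenceOrderForcesSSB
import Summits.HubbardSuperconductivity.HubbardSuperconductivity.Theorems.NodalDiracTwistBridgeNodalToDWaveEnergyMatching
import Summits.HubbardSuperconductivity.HubbardSuperconductivity.Theorems.NodalDiracTwistBridgeNodalToDWaveSourcedEnergyDensityLimit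
import Literature.MathematicalPhysics.QuantumLattice.SpinTwistedHubbardTorus
import Literature.MathematicalPhysics.QuantumLattice.DWaveSource
import Literature.MathematicalPhysics.QuantumLattice.PairCorrelationsProofs
import Literature.MathematicalPhysics.QuantumLattice.LatticeToriLROProofs
import Summits.HubbardSuperconductivity.HubbardSuperconductivity.Theses.NodalDiracTwist
import Summits.HubbardSuperconductivity.HubbardSuperconductivity.Theses.AposterioriCapRg

/-!
# Strategist split of `BridgeNodalToDWave` (stmt-10395) — SELF-CONTAINED δ-MATCH CERTIFICATE (crux-strategist s1, 2026-08-17)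
#
# This check file re-elaborates the glue theorem of `Cruxes/BridgeNodalToDWave/StrategistSplit.lean` (identical text, namespace
# `…Cruxes.BridgeNodalToDWave.StrategistSplitCheck`) together with the two Theses imports, and then certifies by the identity
# function that its type IS `ClassificationCore → DensityMatchedWindow → Theses.AposterioriCapRg.SsbToEvenTorusLro →
# Theses.NodalDiracTwist.BridgeNodalToDWave` over the NAMED decls (`glue_check`), plus `Iff.rfl` of child 3 with stmt-1315.
# (Self-contained because the farm had not yet built the StrategistSplit module when this was written.)
#
# Original header of the glue file follows.

Glue file for the D-0019 glued split of `Theses.NodalDiracTwist.BridgeNodalToDWave` filed by the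
crux-strategist seat (`ledger route edit … --split BridgeNodalToDWave --into children.json`):

  `ClassificationCore → DensityMatchedWindow → SsbToEvenTorusLro → BridgeNodalToDWave`  (k = 3).

It is the composition of skeleton v10 of line `birth` (`Cruxes/BridgeNodalToDWave/Lines/birth.lean`, lead
c12, commit b70efcf39ca5; compare the landed p147723
`Theorems/NodalDiracTwistBridgeNodalToDWaveOfClassificationCore.lean`, whose EOS hypothesis is the
stronger `RegularEquationOfStateIcc`), rebuilt

* THESES-FREE — it imports neither `Theses.NodalDiracTwist` nor `Theses.AposterioriCapRg`, so the gate can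
  import THIS module into the route file (for `--glue-by`) without an import cycle; the conclusion is the
  BODY of `BridgeNodalToDWave` verbatim (ledger signature of stmt-10395) and hypothesis 3 is the BODY of
  the shared item `SsbToEvenTorusLro` (stmt-HubbardSuperconductivity-1315) verbatim;
* DEF-FREE — hypotheses 1–2 are VERBATIM the two open registered stubs of skeleton v10
  (`stub_classificationCore` = C, `stub_densityMatchedWindow` = D3c'), which become the route's new
  sub-cruxes `ClassificationCore`, `DensityMatchedWindow`.

Content (the lead programme's bricks, all landed `--supports stmt-10395`, all Theses-free):
A `stub_ndSpeaksFrequently` (p141870: `ND` speaks on infinitely many even sides), B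
`stub_uniqueGroundStateOfPackage` (p141864: where it speaks the untwisted sector ground state is unique),
D1 `stub_subsequenceOrderForcesSSB` (p142988: Koma–Tasaki forward leg, frequent pair order ⇒
`HasDWaveOrder U μ` given energy matching and the sourced thermodynamic limit), D3a
`stub_sourcedEnergyDensityLimit` (p143420), D3b `stub_energyMatchingOfDensityMatching` (p143074).
Proof: hypothesis 1 + A + B give the `d`-wave pair floor `c₀ ≤ F_ψ(k)` of the given admissible family for
infinitely many `k` (the proof of p147723's `nodalOrderAlongSubsequence_of_classificationCore`, inlined);
hypothesis 2 gives a density-matched `μ`; D3b, D3a, D1 give `HasDWaveOrder U μ`; hypothesis 3 returns the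
Statement's LRO for every admissible family, in particular the given one.

Nothing is claimed about the three hypotheses (open: the classification conjecture C with its named
competitor, the nodal liquid; the weak-coupling `T = 0` equation of state; Koma–Tasaki's converse
problem = stmt-1315).  The file certifies that the crux is a pure glue node over them.
Sources: Koma–Tasaki, J. Stat. Phys. 76 (1994) 745, Thm 2.3; Scalapino, Phys. Rep. 250 (1995) 329, §2
eq. (2.4); Ruelle (1969) §3.4; ArovasBergKivelsonRaghu2022 §5.1. [folklore]
-/

-- the mandated namespace repeats `HubbardSuperconductivity` (single-problem summit, D-0017)
set_option linter.dupNamespace false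

namespace Summit.HubbardSuperconductivity.HubbardSuperconductivity.Cruxes.BridgeNodalToDWave.StrategistSplitCheck

open Filter Finset Matrix
open Literature.Probability.LatticeModels Literature.MathematicalPhysics.QuantumLattice
open Summit.HubbardSuperconductivity.HubbardSuperconductivity.Theorems.NodalDiracTwist.BridgeNodalToDWave
open scoped ComplexOrder Topology

/-- One term of the Statement's LRO sequence at side `L + 1` is the normalised pair-field
expectation `re ⟨ψ_{L+1}, Δ_g† Δ_g ψ_{L+1}⟩ / (L+1)⁴` (`sum_torusPullback_succ`, `sum_pairFieldCorr_succ`).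
Scalapino, Phys. Rep. 250 (1995) 329, §2 eq. (2.4). [folklore] -/
theorem lroSeq_succ_eq_expect_split (g : Literature.Probability.LatticeModels.Site 2 → ℝ)
    (ψ : ∀ L, Fock (Orb (FermionTorus 2 L))) (L : ℕ) :
    (∑ x ∈ halfOpenBox 2 (L + 1), ∑ y ∈ halfOpenBox 2 (L + 1),
        torusPullback (pairFieldCorr g ψ) (L + 1) x y) / ((halfOpenBox 2 (L + 1)).card : ℝ) ^ 2 =
      (expect ((pairField g (L + 1))ᴴ * pairField g (L + 1)) (ψ (L + 1))).re /
        ((L + 1 : ℕ) : ℝ) ^ 4 := by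
  rw [sum_torusPullback_succ, sum_pairFieldCorr_succ]

/-- **Split glue of the crux `BridgeNodalToDWave`** — `ClassificationCore → DensityMatchedWindow →
SsbToEvenTorusLro → BridgeNodalToDWave`, every decl replaced by its body (CONDITIONAL on the three
hypotheses; nothing asserted).  Koma–Tasaki, J. Stat. Phys. 76 (1994) 745, Thm 2.3; Scalapino,
Phys. Rep. 250 (1995) 329, §2 eq. (2.4). [folklore] -/
theorem bridgeNodalToDWave_of_subs
    (hC : ∃ U₀ : ℝ, 0 < U₀ ∧ ∀ U ∈ Set.Ioo (0 : ℝ) U₀, ∀ δ ∈ Set.Icc (1 / 10 : ℝ) (3 / 10), ∃ c₀ : ℝ, 0 < c₀ ∧ ∃ L₁ : ℕ, ∀ (L : ℕ) [NeZero L], Even L → L₁ ≤ L → (∃ c : ℝ, 0 < c ∧ c < Real.pi ∧ (∀ φ : Fin 2 → ℝ, φ 0 ∈ Set.Ioc (-Real.pi) Real.pi → φ 1 ∈ Set.Ioc (-Real.pi) Real.pi → ((∃ ψ₁ ψ₂ : Literature.MathematicalPhysics.QuantumLattice.Fock (Literature.MathematicalPhysics.QuantumLattice.Orb (Literature.MathematicalPhysics.QuantumLattice.FermionTorus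 2 L)), Literature.MathematicalPhysics.QuantumLattice.IsGroundStateInSector (Literature.MathematicalPhysics.QuantumLattice.spinTwistedHubbardTorus L U φ) (2 * ⌊(1 - δ) * (L : ℝ) ^ 2 / 2⌋₊) 0 ψ₁ ∧ Literature.MathematicalPhysics.QuantumLattice.IsGroundStateInSector (Literature.MathematicalPhysics.QuantumLattice.spinTwistedHubbardTorus L U φ) (2 * ⌊(1 - δ) * (L : ℝ) ^ 2 / 2⌋₊) 0 ψ₂ ∧ star ψ₁ ⬝ᵥ ψ₂ = 0) ↔ (|φ 0| = c ∧ |φ 1| = c))) ∧ (∀ p : Fin 2 → ℝ, |p 0| = c → |p 1| = c → ∀ r : ℝ, 0 < r → r < min c (Real.pi - c) → ∃ n₀ : ℕ, ∀ n ≥ n₀, ∀ ψ : Fin n → Literature.MathematicalPhysics.QuantumLattice.Fock (Literature.MathematicalPhysics.QuantumLattice.Orb (Literature.MathematicalPhysics.QuantumLattice.FermionTorus 2 L)), (∀ i : Fin n, Literature.MathematicalPhysics.QuantumLattice.IsGroundStateInSector (Literature.MathematicalPhysics.QuantumLattice.spinTwistedHubbardTorus L U (fun ν : Fin 2 => p ν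 + r * (if ν = 0 then Real.cos (2 * Real.pi * (i : ℕ) / n) else Real.sin (2 * Real.pi * (i : ℕ) / n)))) (2 * ⌊(1 - δ) * (L : ℝ) ^ 2 / 2⌋₊) 0 (ψ i) ∧ star (ψ i) ⬝ᵥ ψ i = 1) → (∏ i : Fin n, star (ψ i) ⬝ᵥ ψ (finRotate n i)).re < 0)) → (∀ χ₁ χ₂ : Literature.MathematicalPhysics.QuantumLattice.Fock (Literature.MathematicalPhysics.QuantumLattice.Orb (Literature.MathematicalPhysics.QuantumLattice.FermionTorus 2 L)), Literature.MathematicalPhysics.QuantumLattice.IsGroundStateInSector (Literature.MathematicalPhysics.QuantumLattice.hubbardTorus 2 L 1 U) (2 * ⌊(1 - δ) * (L : ℝ) ^ 2 / 2⌋₊) 0 χ₁ → Literature.MathematicalPhysics.QuantumLattice.IsGroundStateInSector (Literature.MathematicalPhysics.QuantumLattice.hubbardTorus 2 L 1 U) (2 * ⌊(1 - δ) * (L : ℝ) ^ 2 / 2⌋₊) 0 χ₂ → ∃ z : ℂ, χ₂ = z • χ₁) → ∀ χ : Literature.MathematicalPhysics.QuantumLattice.Fock (Literature.MathematicalPhysics.QuantumLattice.Orb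 (Literature.MathematicalPhysics.QuantumLattice.FermionTorus 2 L)), Literature.MathematicalPhysics.QuantumLattice.IsGroundStateInSector (Literature.MathematicalPhysics.QuantumLattice.hubbardTorus 2 L 1 U) (2 * ⌊(1 - δ) * (L : ℝ) ^ 2 / 2⌋₊) 0 χ → star χ ⬝ᵥ χ = 1 → c₀ * (L : ℝ) ^ 4 ≤ (Literature.MathematicalPhysics.QuantumLattice.expect ((Literature.MathematicalPhysics.QuantumLattice.pairField Literature.MathematicalPhysics.QuantumLattice.dWaveFormFactor L)ᴴ * Literature.MathematicalPhysics.QuantumLattice.pairField Literature.MathematicalPhysics.QuantumLattice.dWaveFormFactor L) χ).re)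
    (hDMW : ∃ U₂ : ℝ, 0 < U₂ ∧ ∀ U ∈ Set.Ioo (0 : ℝ) U₂, ∀ δ ∈ Set.Icc (1 / 10 : ℝ) (3 / 10), ∃ μ : ℝ, Filter.Tendsto (fun L : ℕ => ((Literature.MathematicalPhysics.QuantumLattice.hubbardTorusWith 2 (L + 1) 1 U μ).groundStateFunctional Literature.MathematicalPhysics.QuantumLattice.totalNumber).re / ((L + 1 : ℕ) : ℝ) ^ 2) Filter.atTop (nhds (1 - δ)))
    (h1315 : ∀ (U δ μ : ℝ), 0 < U → δ ∈ Set.Ioo (0:ℝ) 1 → Filter.Tendsto (fun L : ℕ => ((Literature.MathematicalPhysics.QuantumLattice.hubbardTorusWith 2 (L + 1) 1 U μ).groundStateFunctional Literature.MathematicalPhysics.QuantumLattice.totalNumber).re / ((L + 1 : ℕ) : ℝ) ^ 2) Filter.atTop (nhds (1 - δ)) → Literature.MathematicalPhysics.QuantumLattice.HasDWaveOrder U μ → ∀ (N : ℕ → ℕ) (ψ : ∀ L, Literature.MathematicalPhysics.QuantumLattice.Fock (Literature.MathematicalPhysics.QuantumLattice.Orb (Literature.MathematicalPhysics.QuantumLattice.FermionTorus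 2 L))), (∀ L, Even L → N L = 2 * ⌊(1 - δ) * (L : ℝ) ^ 2 / 2⌋₊ ∧ star (ψ L) ⬝ᵥ ψ L = 1 ∧ Literature.MathematicalPhysics.QuantumLattice.IsGroundStateInSector (Literature.MathematicalPhysics.QuantumLattice.hubbardTorus 2 L 1 U) (N L) 0 (ψ L)) → Literature.Probability.LatticeModels.HasLongRangeOrder (fun k => Literature.Probability.LatticeModels.halfOpenBox 2 (2 * k)) (fun k => Literature.MathematicalPhysics.QuantumLattice.torusPullback (Literature.MathematicalPhysics.QuantumLattice.pairFieldCorr Literature.MathematicalPhysics.QuantumLattice.dWaveFormFactor ψ) (2 * k))) :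
    ∃ U₀ : ℝ, 0 < U₀ ∧ ∀ U ∈ Set.Ioo (0 : ℝ) U₀, ∀ δ ∈ Set.Icc (1 / 10 : ℝ) (3 / 10), (∃ κ : ℝ, 0 < κ ∧ κ < Real.pi ∧ Real.cos κ ≠ 0 ∧ ∀ ε : ℝ, 0 < ε → ∃ L₀ : ℕ, ∀ (L : ℕ) [NeZero L], Even L → L₀ ≤ L → (∀ m : ℤ, ε ≤ |L * κ - m * Real.pi|) → let sh : Literature.MathematicalPhysics.QuantumLattice.FermionTorus 2 L → Fin 2 → Literature.MathematicalPhysics.QuantumLattice.FermionTorus 2 L := fun x μ => toLex (Function.update (ofLex x) μ (ofLex x μ + 1)); let a := fun (x : Literature.MathematicalPhysics.QuantumLattice.FermionTorus 2 L) (σ : Fin 2) => Literature.MathematicalPhysics.QuantumLattice.annihilation (Literature.MathematicalPhysics.QuantumLattice.orb x σ); let H := fun φ : Fin 2 → ℝ => -(∑ x : Literature.MathematicalPhysics.QuantumLattice.FermionTorus 2 L, ∑ μ : Fin 2, ∑ σ : Fin 2, (Complex.exp (Complex.I * (((-1 : ℝ) ^ (σ : ℕ) * φ μ / L : ℝ)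 : ℂ)) • (Matrix.conjTranspose (a x σ) * a (sh x μ) σ) + Complex.exp (-(Complex.I * (((-1 : ℝ) ^ (σ : ℕ) * φ μ / L : ℝ) : ℂ))) • (Matrix.conjTranspose (a (sh x μ) σ) * a x σ))) + (U : ℂ) • ∑ x : Literature.MathematicalPhysics.QuantumLattice.FermionTorus 2 L, Literature.MathematicalPhysics.QuantumLattice.numberOp x 0 * Literature.MathematicalPhysics.QuantumLattice.numberOp x 1; ∃ c : ℝ, 0 < c ∧ c < Real.pi ∧ |Real.cos c - Real.cos (L * κ)| ≤ ε ∧ (∀ φ : Fin 2 → ℝ, φ 0 ∈ Set.Ioc (-Real.pi) Real.pi → φ 1 ∈ Set.Ioc (-Real.pi) Real.pi → ((∃ ψ₁ ψ₂, Literature.MathematicalPhysics.QuantumLattice.IsGroundStateInSector (H φ) (2 * ⌊(1 - δ) * (L : ℝ) ^ 2 / 2⌋₊) 0 ψ₁ ∧ Literature.MathematicalPhysics.QuantumLattice.IsGroundStateInSector (H φ) (2 * ⌊(1 - δ) * (L : ℝ) ^ 2 / 2⌋₊) 0 ψ₂ ∧ star ψ₁ ⬝ᵥ ψ₂ = 0)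 ↔ (|φ 0| = c ∧ |φ 1| = c))) ∧ (∀ p : Fin 2 → ℝ, |p 0| = c → |p 1| = c → ∀ r : ℝ, 0 < r → r < min c (Real.pi - c) → ∃ n₀ : ℕ, ∀ n ≥ n₀, ∀ ψ : Fin n → (Finset (Literature.MathematicalPhysics.QuantumLattice.Orb (Literature.MathematicalPhysics.QuantumLattice.FermionTorus 2 L)) → ℂ), (∀ i : Fin n, Literature.MathematicalPhysics.QuantumLattice.IsGroundStateInSector (H (fun ν : Fin 2 => p ν + r * (if ν = 0 then Real.cos (2 * Real.pi * (i : ℕ) / n) else Real.sin (2 * Real.pi * (i : ℕ) / n)))) (2 * ⌊(1 - δ) * (L : ℝ) ^ 2 / 2⌋₊) 0 (ψ i) ∧ star (ψ i) ⬝ᵥ ψ i = 1) → (∏ i : Fin n, star (ψ i) ⬝ᵥ ψ (finRotate n i)).re < 0)) → ∀ (N : ℕ → ℕ) (ψ : ∀ L, Literature.MathematicalPhysics.QuantumLattice.Fock (Literature.MathematicalPhysics.QuantumLattice.Orb (Literature.MathematicalPhysics.QuantumLattice.FermionTorus 2 L))), (∀ L, Even L → N L = 2 * ⌊(1 - δ)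 * (L : ℝ) ^ 2 / 2⌋₊ ∧ star (ψ L) ⬝ᵥ ψ L = 1 ∧ Literature.MathematicalPhysics.QuantumLattice.IsGroundStateInSector (Literature.MathematicalPhysics.QuantumLattice.hubbardTorus 2 L 1 U) (N L) 0 (ψ L)) → Literature.Probability.LatticeModels.HasLongRangeOrder (fun k => Literature.Probability.LatticeModels.halfOpenBox 2 (2 * k)) (fun k => Literature.MathematicalPhysics.QuantumLattice.torusPullback (Literature.MathematicalPhysics.QuantumLattice.pairFieldCorr Literature.MathematicalPhysics.QuantumLattice.dWaveFormFactor ψ) (2 * k)) := by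
  have hA := stub_ndSpeaksFrequently
  have hB := stub_uniqueGroundStateOfPackage
  have hD1 := stub_subsequenceOrderForcesSSB
  have hD3a := stub_sourcedEnergyDensityLimit
  have hD3b := stub_energyMatchingOfDensityMatching
  obtain ⟨U₀, hU₀, hC⟩ := hC
  obtain ⟨U₂, hU₂, h3⟩ := hDMW
  refine ⟨min U₀ U₂, lt_min hU₀ hU₂, ?_⟩
  intro U hU δ hδ hND N ψ hyp
  have hU0 : U ∈ Set.Ioo (0 : ℝ) U₀ := ⟨hU.1, lt_of_lt_of_le hU.2 (min_le_left _ _)⟩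
  have hU2 : U ∈ Set.Ioo (0 : ℝ) U₂ := ⟨hU.1, lt_of_lt_of_le hU.2 (min_le_right _ _)⟩
  -- Step 1 (hypothesis 1 + A + B): the `d`-wave pair floor of the given family along infinitely many `k`.
  have hfreq : ∃ c : ℝ, 0 < c ∧ ∃ᶠ k : ℕ in Filter.atTop, c ≤ (∑ x ∈ halfOpenBox 2 (2 * k),
      ∑ y ∈ halfOpenBox 2 (2 * k), torusPullback (pairFieldCorr dWaveFormFactor ψ) (2 * k) x y) /
      ((halfOpenBox 2 (2 * k)).card : ℝ) ^ 2 := by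
    obtain ⟨κ, hκ0, hκπ, hcos, hND⟩ := hND
    obtain ⟨c₀, hc₀, L₁, hC⟩ := hC U hU0 δ hδ
    obtain ⟨ε, hε, hA⟩ := hA κ hκ0 hκπ hcos
    obtain ⟨L₀, hND⟩ := hND ε hε
    refine ⟨c₀, hc₀, Filter.frequently_atTop.2 fun a => ?_⟩
    obtain ⟨L, hLge, hLeven, hLres⟩ := hA (max (2 * a) (max L₀ (max L₁ 3)))
    have haL : 2 * a ≤ L := le_trans (le_max_left _ _) hLge
    have hL0 : L₀ ≤ L := le_trans (le_trans (le_max_left _ _) (le_max_right _ _)) hLge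
    have hL1 : L₁ ≤ L := le_trans (le_trans (le_trans (le_max_left _ _) (le_max_right _ _))
      (le_max_right _ _)) hLge
    have hL3 : 3 ≤ L := le_trans (le_trans (le_trans (le_max_right _ _) (le_max_right _ _))
      (le_max_right _ _)) hLge
    obtain ⟨k, hk⟩ := hLeven
    have hLk : L = 2 * k := by omega
    refine ⟨k, by omega, ?_⟩
    haveI : NeZero L := ⟨by omega⟩
    -- the package clause at side `L`
    obtain ⟨c, hc0, hcπ, -, hI, hII⟩ := hND L ⟨k, hk⟩ hL0 hLres
    -- (B): uniqueness of the untwisted sector ground state, from clause (I) at `φ = 0`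
    have hnot : ¬ ∃ ψ₁ ψ₂ : Fock (Orb (FermionTorus 2 L)),
        IsGroundStateInSector (spinTwistedHubbardTorus L U 0) (2 * ⌊(1 - δ) * (L : ℝ) ^ 2 / 2⌋₊) 0 ψ₁ ∧
        IsGroundStateInSector (spinTwistedHubbardTorus L U 0) (2 * ⌊(1 - δ) * (L : ℝ) ^ 2 / 2⌋₊) 0 ψ₂ ∧
        star ψ₁ ⬝ᵥ ψ₂ = 0 := by
      intro hex
      have h0 : (0 : Fin 2 → ℝ) 0 ∈ Set.Ioc (-Real.pi) Real.pi :=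
        ⟨by simpa using Real.pi_pos, by simpa using Real.pi_pos.le⟩
      have h := (hI 0 h0 h0).1 hex
      simp only [Pi.zero_apply, abs_zero] at h
      exact absurd h.1 (ne_of_lt hc0)
    have huniq := hB L hL3 U (2 * ⌊(1 - δ) * (L : ℝ) ^ 2 / 2⌋₊) hnot
    -- (C): the pair-order floor at side `L`
    have hfloor := hC L ⟨k, hk⟩ hL1 ⟨c, hc0, hcπ, hI, hII⟩ huniq
    obtain ⟨hN, hnormL, hGS⟩ := hyp L ⟨k, hk⟩
    rw [hN] at hGS
    have hle := hfloor (ψ L) hGS hnormL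
    -- rewrite the `k`-th term of the LRO sequence (side `2k = (2k-1)+1`) as the normalised expectation
    obtain ⟨L', hL'⟩ : ∃ L' : ℕ, 2 * k = L' + 1 := ⟨2 * k - 1, by omega⟩
    rw [hL', lroSeq_succ_eq_expect_split, le_div_iff₀ (by positivity)]
    have hLL' : L = L' + 1 := by omega
    subst hLL'
    exact hle
  -- Step 2 (hypothesis 2, D3b, D3a, D1): Koma–Tasaki `d`-wave order at a density-matched `μ`.
  obtain ⟨c, hc, hfreq⟩ := hfreq
  obtain ⟨μ, hDM⟩ := h3 U hU2 δ hδ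
  have hEM := hD3b U δ μ hU.1 hδ hDM
  have hTL := fun h (hh : (0 : ℝ) ≤ h) => hD3a U μ h hU.1.le hh
  have hOrder : HasDWaveOrder U μ := hD1 U δ μ hU.1 hδ hTL hEM N ψ hyp ⟨c, hc, hfreq⟩
  -- Step 3 (hypothesis 3): the every-ground-state transfer returns the Statement's LRO for this family.
  have hδ' : δ ∈ Set.Ioo (0 : ℝ) 1 := ⟨by linarith [hδ.1], by linarith [hδ.2]⟩
  exact h1315 U δ μ hU.1 hδ' hDM hOrder N ψ hyp

end Summit.HubbardSuperconductivity.HubbardSuperconductivity.Cruxes.BridgeNodalToDWave.StrategistSplitCheck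

-- ===== δ-match certificate (SplitGlueCheck.lean body) =====

/-!
# δ-match certificate for the strategist split glue of `BridgeNodalToDWave` (stmt-10395)

`glue_check` re-types the Theses-free, def-free glue `bridgeNodalToDWave_of_subs` against the NAMED
decls: hypotheses 1–2 as the children's statement texts (what `--into children.json` files), hypothesis 3
as the existing item decl `Theses.AposterioriCapRg.SsbToEvenTorusLro` (stmt-1315), conclusion the crux
`Theses.NodalDiracTwist.BridgeNodalToDWave` BY NAME — by the identity function, i.e. definitional
unfolding only. [folklore]
-/

set_option linter.dupNamespace false

namespace Summit.HubbardSuperconductivity.HubbardSuperconductivity.Cruxes.BridgeNodalToDWave.StrategistSplitCheck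

-- the route file `Theses/NodalDiracTwist.lean` has `open scoped … Matrix …` in effect (postfix `ᴴ`, `⬝ᵥ`)
open scoped Matrix ComplexOrder

/-- Child 1 of the split, as filed (= registered stub `stub_classificationCore`). [folklore] -/
def ClassificationCore : Prop := ∃ U₀ : ℝ, 0 < U₀ ∧ ∀ U ∈ Set.Ioo (0 : ℝ) U₀, ∀ δ ∈ Set.Icc (1 / 10 : ℝ) (3 / 10), ∃ c₀ : ℝ, 0 < c₀ ∧ ∃ L₁ : ℕ, ∀ (L : ℕ) [NeZero L], Even L → L₁ ≤ L → (∃ c : ℝ, 0 < c ∧ c < Real.pi ∧ (∀ φ : Fin 2 → ℝ, φ 0 ∈ Set.Ioc (-Real.pi) Real.pi → φ 1 ∈ Set.Ioc (-Real.pi) Real.pi → ((∃ ψ₁ ψ₂ : Literature.MathematicalPhysics.QuantumLattice.Fock (Literature.MathematicalPhysics.QuantumLattice.Orb (Literature.MathematicalPhysics.QuantumLattice.FermionTorus 2 L)), Literature.MathematicalPhysics.QuantumLattice.IsGroundStateInSector (Literature.MathematicalPhysics.QuantumLattice.spinTwistedHubbardTorus L U φ) (2 * ⌊(1 - δ) *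 (L : ℝ) ^ 2 / 2⌋₊) 0 ψ₁ ∧ Literature.MathematicalPhysics.QuantumLattice.IsGroundStateInSector (Literature.MathematicalPhysics.QuantumLattice.spinTwistedHubbardTorus L U φ) (2 * ⌊(1 - δ) * (L : ℝ) ^ 2 / 2⌋₊) 0 ψ₂ ∧ star ψ₁ ⬝ᵥ ψ₂ = 0) ↔ (|φ 0| = c ∧ |φ 1| = c))) ∧ (∀ p : Fin 2 → ℝ, |p 0| = c → |p 1| = c → ∀ r : ℝ, 0 < r → r < min c (Real.pi - c) → ∃ n₀ : ℕ, ∀ n ≥ n₀, ∀ ψ : Fin n → Literature.MathematicalPhysics.QuantumLattice.Fock (Literature.MathematicalPhysics.QuantumLattice.Orb (Literature.MathematicalPhysics.QuantumLattice.FermionTorus 2 L)), (∀ i : Fin n, Literature.MathematicalPhysics.QuantumLattice.IsGroundStateInSector (Literature.MathematicalPhysics.QuantumLattice.spinTwistedHubbardTorus L U (fun ν : Fin 2 => p ν + r * (if ν = 0 then Real.cos (2 * Real.pi * (i : ℕ) / n) else Real.sin (2 * Real.pi * (i : ℕ) / n)))) (2 * ⌊(1 - δ) * (L : ℝ) ^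 2 / 2⌋₊) 0 (ψ i) ∧ star (ψ i) ⬝ᵥ ψ i = 1) → (∏ i : Fin n, star (ψ i) ⬝ᵥ ψ (finRotate n i)).re < 0)) → (∀ χ₁ χ₂ : Literature.MathematicalPhysics.QuantumLattice.Fock (Literature.MathematicalPhysics.QuantumLattice.Orb (Literature.MathematicalPhysics.QuantumLattice.FermionTorus 2 L)), Literature.MathematicalPhysics.QuantumLattice.IsGroundStateInSector (Literature.MathematicalPhysics.QuantumLattice.hubbardTorus 2 L 1 U) (2 * ⌊(1 - δ) * (L : ℝ) ^ 2 / 2⌋₊) 0 χ₁ → Literature.MathematicalPhysics.QuantumLattice.IsGroundStateInSector (Literature.MathematicalPhysics.QuantumLattice.hubbardTorus 2 L 1 U) (2 * ⌊(1 - δ) * (L : ℝ) ^ 2 / 2⌋₊) 0 χ₂ → ∃ z : ℂ, χ₂ = z • χ₁) → ∀ χ : Literature.MathematicalPhysics.QuantumLattice.Fock (Literature.MathematicalPhysics.QuantumLattice.Orb (Literature.MathematicalPhysics.QuantumLattice.FermionTorus 2 L)), Literature.MathematicalPhysics.QuantumLattice.IsGroundStateInSector (Literature.MathematicalPhysics.QuantumLattice.hubbardTorus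 2 L 1 U) (2 * ⌊(1 - δ) * (L : ℝ) ^ 2 / 2⌋₊) 0 χ → star χ ⬝ᵥ χ = 1 → c₀ * (L : ℝ) ^ 4 ≤ (Literature.MathematicalPhysics.QuantumLattice.expect ((Literature.MathematicalPhysics.QuantumLattice.pairField Literature.MathematicalPhysics.QuantumLattice.dWaveFormFactor L)ᴴ * Literature.MathematicalPhysics.QuantumLattice.pairField Literature.MathematicalPhysics.QuantumLattice.dWaveFormFactor L) χ).re

/-- Child 2 of the split, as filed (= registered stub `stub_densityMatchedWindow`). [folklore] -/
def DensityMatchedWindow : Prop := ∃ U₂ : ℝ, 0 < U₂ ∧ ∀ U ∈ Set.Ioo (0 : ℝ) U₂, ∀ δ ∈ Set.Icc (1 / 10 : ℝ) (3 / 10), ∃ μ : ℝ, Filter.Tendsto (fun L : ℕ => ((Literature.MathematicalPhysics.QuantumLattice.hubbardTorusWith 2 (L + 1) 1 U μ).groundStateFunctional Literature.MathematicalPhysics.QuantumLattice.totalNumber).re / ((L + 1 : ℕ) : ℝ) ^ 2) Filter.atTop (nhds (1 - δ))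

/-- δ-match: the glue's type IS `ClassificationCore → DensityMatchedWindow → SsbToEvenTorusLro →
BridgeNodalToDWave` over the named decls. [folklore] -/
theorem glue_check : ClassificationCore → DensityMatchedWindow →
    Summit.HubbardSuperconductivity.HubbardSuperconductivity.Theses.AposterioriCapRg.SsbToEvenTorusLro →
    Summit.HubbardSuperconductivity.HubbardSuperconductivity.Theses.NodalDiracTwist.BridgeNodalToDWave :=
  fun hC hD h3 => bridgeNodalToDWave_of_subs hC hD h3

/-- Child 3 as filed is byte-identical to stmt-1315's signature: `Iff.rfl`. [folklore] -/
example : Summit.HubbardSuperconductivity.HubbardSuperconductivity.Theses.AposterioriCapRg.SsbToEvenTorusLro ↔ (∀ (U δ μ : ℝ), 0 < U → δ ∈ Set.Ioo (0:ℝ) 1 → Filter.Tendsto (fun L : ℕ => ((Literature.MathematicalPhysics.QuantumLattice.hubbardTorusWith 2 (L + 1) 1 U μ).groundStateFunctional Literature.MathematicalPhysics.QuantumLattice.totalNumber).re / ((L + 1 : ℕ) : ℝ) ^ 2) Filter.atTop (nhds (1 - δ)) → Literature.MathematicalPhysics.QuantumLattice.HasDWaveOrder U μ → ∀ (N : ℕ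 → ℕ) (ψ : ∀ L, Literature.MathematicalPhysics.QuantumLattice.Fock (Literature.MathematicalPhysics.QuantumLattice.Orb (Literature.MathematicalPhysics.QuantumLattice.FermionTorus 2 L))), (∀ L, Even L → N L = 2 * ⌊(1 - δ) * (L : ℝ) ^ 2 / 2⌋₊ ∧ star (ψ L) ⬝ᵥ ψ L = 1 ∧ Literature.MathematicalPhysics.QuantumLattice.IsGroundStateInSector (Literature.MathematicalPhysics.QuantumLattice.hubbardTorus 2 L 1 U) (N L) 0 (ψ L)) → Literature.Probability.LatticeModels.HasLongRangeOrder (fun k => Literature.Probability.LatticeModels.halfOpenBox 2 (2 * k)) (fun k => Literature.MathematicalPhysics.QuantumLattice.torusPullback (Literature.MathematicalPhysics.QuantumLattice.pairFieldCorr Literature.MathematicalPhysics.QuantumLattice.dWaveFormFactor ψ) (2 * k))) :=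
  Iff.rfl

end Summit.HubbardSuperconductivity.HubbardSuperconductivity.Cruxes.BridgeNodalToDWave.StrategistSplitCheck
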